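import Mathlib
import HarnessLib
import Literature.Analysis.Approximation.InterpolationRemainder
import Summits.HubbardSuperconductivity.HubbardSuperconductivity.Theorems.KLProgrammeC4aPartnerBandCritical
import Summits.HubbardSuperconductivity.HubbardSuperconductivity.Theorems.KLProgrammeC4aBubbleTubeDerivAll

/-!
# Route `KLProgramme` — crux C4a, S3 brick (B4, DIRECT SHEET): TWO-NODE CONTROL — a loop-angle profile that vanishes at the two θ-fixed
# crossings is controlled by the convex one; hence the co-moving jets of the pp partner band are bounded by the BAND DISTANCE itself

Cell `gate-hubbard-kl`, seat hubbard-kl-k3c3-p3 (g25; row «implicit-function / monotonicity route for μ(n)»).  Located brick «(B4)-DIRECT-COUNT» for the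
(C)-closer lane hubbard-kl-c4a-1 (stub (C) `stub_twoLeg_curvature` of `KLRegimeEngineV17F2`, stmt-HubbardSuperconductivity-20437; memo
HOME/hubbard-kl-c4a-1/C4A-PLAN.md §24.4–§24.6 (B4), HOME/hubbard-kl-k3c3-p3/B4-DIRECT-COUNT.md).

WHY.  §24.4's (B4) power counting pairs every base-angle derivative falling on the partner propagator `Ψ(ē)` with one ANISOTROPY-DEFECT factor
`∂ᵐ_θ ē`.  The (B2) tables bound that factor by `C·(φ² + |e| + |ρ| + |ϑ − ϑ_T|)` near the tangency configuration; the `|ϑ|`-term is lossy at the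
SECOND direct crossing `φ = ϑ` (loop at `q′`, partner at `k`), where every `θ`-jet of `ē` vanishes identically.  The sharp statement is that on the
direct sheet the defect is controlled by the two band distances, `|∂ᵐ_θ ē| ≤ C_m·(|e| + |ē| + |ρ|)`; with it every derivative on the coarser line of a
shell pair is paid by that line's own scale (memo §2), and no integration by parts is needed on the direct sheet.  This file types the mechanism at
loop level `e = 0`, `ρ = 0` — the TWO-NODE CONTROL — and its transport to `e ≠ 0`:

* §1 (carrier-free, from the tree's `Literature.Analysis.Approximation.exists_interpolation_remainder` with the two nodes `{0, ϑ}` and the zero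
  interpolant): for `f ∈ C²` with `f(0) = f(ϑ) = 0`, `ϑ ≠ 0`, on an interval `[a,b] ∋ 0, ϑ, t`:
  `f(t) = ½ f″(ξ)·t(t − ϑ)` (`exists_eq_half_deriv_two_mul_of_two_zeros`), hence **`abs_le_half_mul_of_two_zeros`** (`|f t| ≤ M/2·|t||t−ϑ|` if `|f″| ≤ M`),
  **`mul_le_abs_of_two_zeros_of_convex`** (`c·|t||t−ϑ| ≤ |f t|` if `2c ≤ f″`), and the quotient form **`abs_le_mul_abs_of_two_zeros`**: if `f, h ∈ C²` both
  vanish at `0` and `ϑ`, `2c ≤ f″` (`0 < c`) and `|h″| ≤ M` on `[a,b]`, then `|h t| ≤ (M/(2c))·|f t|` — `h` is controlled by the convex profile `f`;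
  `abs_le_mul_abs_add_of_two_zeros` transports it along a Lipschitz displacement (`|H − h| ≤ ℓ₁`, `|F − f| ≤ ℓ₀` ⇒ `|H| ≤ (M/2c)|F| + (M/2c)ℓ₀ + ℓ₁`).
* §2 (sections of a jointly smooth function, after `…C4aBubbleTubeDerivAll`): `iteratedDeriv m` in the second variable of a `C^∞` map `G : ℝ × ℝ → F`
  is again (the section of) a `C^∞` map (`exists_contDiff_section_iteratedDeriv`), so `φ ↦ ∂ᵐ_ψ|_θ G(φ,ψ)` is `C^∞` (`contDiff_iteratedDeriv_section`).
* §3 (the pp partner band at `ρ = 0`, generic `BandBounds` window, binder of `…C4aPartnerBandCritical`): with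
  `P(φ, ψ) := e_K(Φ(0,ψ) + Φ(0,ϑ+ψ) − Φ(0,φ+ψ))` (loop level `0`, base angle `ψ`, loop angle `φ`):
  the two θ-FIXED ZEROS `P(0,ψ) = 0`, `P(ϑ,ψ) = 0` for every `ψ` (`partnerBand_pp_level_zero_at_k/_at_q`), hence every base-angle jet vanishes there
  (`iteratedDeriv_partnerBand_pp_base_at_k/_at_q`); joint smoothness (`contDiff_partnerBand_pp_uncurry`) and smoothness of the jet profiles
  `φ ↦ ∂ᵐ_ψ|_θ P(φ,ψ)` (`contDiff_partnerBand_pp_jet_profile`); and the headline **`abs_iteratedDeriv_partnerBand_pp_base_le_mul_abs`**: on a loop-angle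
  window `[a,b] ∋ 0, ϑ` carrying a curvature floor `2c ≤ ∂²_φ P(·,θ)` (g21's `iteratedDeriv_two_partnerBand_pp_angle_ge` supplies it near tangency under
  `FrameOK`) and a mixed-jet ceiling `|∂²_φ ∂ᵐ_ψ|_θ P| ≤ M` (a table row, hypothesis here),
  `|∂ᵐ_ψ|_θ e_K(Φ(0,ψ) + Φ(0,ϑ+ψ) − Φ(0,φ+ψ))| ≤ (M/(2c))·|e_K(Φ(0,θ) + Φ(0,ϑ+θ) − Φ(0,φ+θ))|` for `φ ∈ [a,b]`, `ϑ ≠ 0` —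
  the `m`-th co-moving jet of the partner band AT THE LOOP'S FERMI LEVEL is bounded by the partner's band distance `|ē|`, uniformly in how close the
  two crossings `0, ϑ` are; `…_le_mul_abs_add_level` adds the loop level `e` through the landed level rows (`|∂ᵐē(e,·) − ∂ᵐē(0,·)| ≤ ℓ_m|e|`, hypotheses
  in the shape of `…C4aPartnerBandTangencyDefectSharp.abs_iteratedDeriv_partnerBand_pp_sub_level_le_sharp`): `|∂ᵐ_θ ē(e,φ)| ≤ (M/2c)|ē(e,φ)| + ((M/2c)ℓ₀ + ℓ_m)|e|`.

Pure calculus on landed objects; the curvature floor and the mixed-jet ceiling are hypotheses (rows); nothing about the Hubbard model's sizes; nothing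
asserts (C), K3 or superconductivity.  References: FST II = Feldman–Salmhofer–Trubowitz CPAM 51 (1998) §3 (overlapping loops / tangential regularity);
BGM 2006 §2.4 Lemma 2.1 [cite: BenfattoGiulianiMastropietro2006]; Stoer–Bulirsch Thm 2.1.4.1 (interpolation remainder).
-/

noncomputable section

namespace Summit.HubbardSuperconductivity.HubbardSuperconductivity.Theorems.C4a

set_option linter.dupNamespace false -- summit = problem name (single-conjunct summit), D-0017

open Real Set Filter
open scoped Topology ContDiff
open Literature.MathematicalPhysics.QuantumLattice Literature.MathematicalPhysics.QuantumLattice.BandSectorCounting Literature.Probability.LatticeModels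
open Summit.HubbardSuperconductivity.HubbardSuperconductivity.Theorems.KLRegimeSplit
open Summit.HubbardSuperconductivity.HubbardSuperconductivity.Theorems.DispersionFlow
open Summit.HubbardSuperconductivity.HubbardSuperconductivity.Theorems.PerturbedFermiCurve

/-! ## §1 Two-node control (carrier-free) -/

section TwoNode

/-- **Two-node remainder**: `f ∈ C²`, `f(0) = f(ϑ) = 0`, `ϑ ≠ 0`, nodes and `t` in `[a,b]` (`a < b`) ⇒ `f(t) = ½·f″(ξ)·t(t−ϑ)` for some `ξ ∈ (a,b)`
(the interpolation remainder at the nodes `{0, ϑ}` with the zero interpolant). -/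
theorem exists_eq_half_deriv_two_mul_of_two_zeros {f : ℝ → ℝ} (hf : ContDiff ℝ 2 f) {ϑ : ℝ} (hϑ : ϑ ≠ 0) (h0 : f 0 = 0) (hϑ0 : f ϑ = 0)
    {a b : ℝ} (hab : a < b) (ha0 : (0 : ℝ) ∈ Icc a b) (hϑab : ϑ ∈ Icc a b) {t : ℝ} (ht : t ∈ Icc a b) :
    ∃ ξ ∈ Ioo a b, f t = iteratedDeriv 2 f ξ / 2 * (t * (t - ϑ)) := by
  classical
  have hcard : ({0, ϑ} : Finset ℝ).card = 2 := by
    rw [Finset.card_pair hϑ.symm]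
  have hp : (0 : Polynomial ℝ).degree < (2 : ℕ) := by
    rw [Polynomial.degree_zero]; exact WithBot.bot_lt_coe _
  have hfp : ∀ x ∈ ({0, ϑ} : Finset ℝ), (0 : Polynomial ℝ).eval x = f x := by
    intro x hx
    rcases Finset.mem_insert.1 hx with rfl | hx
    · rw [Polynomial.eval_zero, h0]
    · rw [Finset.mem_singleton.1 hx, Polynomial.eval_zero, hϑ0]
  have hs : ∀ x ∈ ({0, ϑ} : Finset ℝ), x ∈ Icc a b := by
    intro x hx
    rcases Finset.mem_insert.1 hx with rfl | hx
    · exact ha0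
    · rw [Finset.mem_singleton.1 hx]; exact hϑab
  obtain ⟨ξ, hξ, h⟩ := Literature.Analysis.Approximation.exists_interpolation_remainder hcard (by norm_num) hf hp hfp hab hs ht
  refine ⟨ξ, hξ, ?_⟩
  rw [Polynomial.eval_zero, sub_zero, Finset.prod_pair hϑ.symm, sub_zero] at h
  rw [h]
  norm_num

/-- **Upper two-node bound**: `|f″| ≤ M` on `[a,b]` ⇒ `|f(t)| ≤ M/2·(|t|·|t−ϑ|)`. -/
theorem abs_le_half_mul_of_two_zeros {f : ℝ → ℝ} (hf : ContDiff ℝ 2 f) {ϑ : ℝ} (hϑ : ϑ ≠ 0) (h0 : f 0 = 0) (hϑ0 : f ϑ = 0)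
    {a b : ℝ} (hab : a < b) (ha0 : (0 : ℝ) ∈ Icc a b) (hϑab : ϑ ∈ Icc a b) {M : ℝ} (hM : ∀ x ∈ Icc a b, |iteratedDeriv 2 f x| ≤ M)
    {t : ℝ} (ht : t ∈ Icc a b) : |f t| ≤ M / 2 * (|t| * |t - ϑ|) := by
  obtain ⟨ξ, hξ, h⟩ := exists_eq_half_deriv_two_mul_of_two_zeros hf hϑ h0 hϑ0 hab ha0 hϑab ht
  rw [h, abs_mul, abs_div, abs_mul, abs_two]
  exact mul_le_mul_of_nonneg_right (div_le_div_of_nonneg_right (hM ξ (Ioo_subset_Icc_self hξ)) zero_le_two) (by positivity)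

/-- **Lower two-node bound (convex profile)**: `2c ≤ f″` on `[a,b]`, `0 ≤ c` ⇒ `c·(|t|·|t−ϑ|) ≤ |f(t)|`. -/
theorem mul_le_abs_of_two_zeros_of_convex {f : ℝ → ℝ} (hf : ContDiff ℝ 2 f) {ϑ : ℝ} (hϑ : ϑ ≠ 0) (h0 : f 0 = 0) (hϑ0 : f ϑ = 0)
    {a b : ℝ} (hab : a < b) (ha0 : (0 : ℝ) ∈ Icc a b) (hϑab : ϑ ∈ Icc a b) {c : ℝ} (hc0 : 0 ≤ c) (hc : ∀ x ∈ Icc a b, 2 * c ≤ iteratedDeriv 2 f x)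
    {t : ℝ} (ht : t ∈ Icc a b) : c * (|t| * |t - ϑ|) ≤ |f t| := by
  obtain ⟨ξ, hξ, h⟩ := exists_eq_half_deriv_two_mul_of_two_zeros hf hϑ h0 hϑ0 hab ha0 hϑab ht
  have hξc : c ≤ iteratedDeriv 2 f ξ / 2 := by have := hc ξ (Ioo_subset_Icc_self hξ); linarith
  rw [h, abs_mul, abs_mul, abs_of_nonneg (hc0.trans hξc)]
  exact mul_le_mul_of_nonneg_right hξc (by positivity)

/-- **The exact sign structure of a convex two-node profile**: `2c ≤ f″`, `0 ≤ c` ⇒ `f(t)·(t(t−ϑ)) ≥ 0` and `f(t) ≥ c·t(t−ϑ)` when `t(t−ϑ) ≥ 0`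
(outside the nodes the profile is positive, between them negative). -/
theorem mul_nonneg_of_two_zeros_of_convex {f : ℝ → ℝ} (hf : ContDiff ℝ 2 f) {ϑ : ℝ} (hϑ : ϑ ≠ 0) (h0 : f 0 = 0) (hϑ0 : f ϑ = 0)
    {a b : ℝ} (hab : a < b) (ha0 : (0 : ℝ) ∈ Icc a b) (hϑab : ϑ ∈ Icc a b) {c : ℝ} (hc0 : 0 ≤ c) (hc : ∀ x ∈ Icc a b, 2 * c ≤ iteratedDeriv 2 f x)
    {t : ℝ} (ht : t ∈ Icc a b) : 0 ≤ f t * (t * (t - ϑ)) := by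
  obtain ⟨ξ, hξ, h⟩ := exists_eq_half_deriv_two_mul_of_two_zeros hf hϑ h0 hϑ0 hab ha0 hϑab ht
  have hξc : 0 ≤ iteratedDeriv 2 f ξ / 2 := by have := hc ξ (Ioo_subset_Icc_self hξ); linarith
  rw [h, mul_assoc]
  exact mul_nonneg hξc (mul_self_nonneg _)

/-- **TWO-NODE CONTROL (quotient form)**: two `C²` profiles vanishing at the same two nodes `0, ϑ` (`ϑ ≠ 0`); if the first is uniformly convex
(`2c ≤ f″`, `0 < c`) and the second has `|h″| ≤ M` on `[a,b] ∋ 0, ϑ`, then `|h(t)| ≤ (M/(2c))·|f(t)|` on `[a,b]` — uniformly in the node distance `|ϑ|`. -/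
theorem abs_le_mul_abs_of_two_zeros {f h : ℝ → ℝ} (hf : ContDiff ℝ 2 f) (hh : ContDiff ℝ 2 h) {ϑ : ℝ} (hϑ : ϑ ≠ 0)
    (hf0 : f 0 = 0) (hfϑ : f ϑ = 0) (hh0 : h 0 = 0) (hhϑ : h ϑ = 0)
    {a b : ℝ} (hab : a < b) (ha0 : (0 : ℝ) ∈ Icc a b) (hϑab : ϑ ∈ Icc a b) {c M : ℝ} (hc0 : 0 < c)
    (hc : ∀ x ∈ Icc a b, 2 * c ≤ iteratedDeriv 2 f x) (hM : ∀ x ∈ Icc a b, |iteratedDeriv 2 h x| ≤ M)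
    {t : ℝ} (ht : t ∈ Icc a b) : |h t| ≤ M / (2 * c) * |f t| := by
  have hup := abs_le_half_mul_of_two_zeros hh hϑ hh0 hhϑ hab ha0 hϑab hM ht
  have hlow := mul_le_abs_of_two_zeros_of_convex hf hϑ hf0 hfϑ hab ha0 hϑab hc0.le hc ht
  have hM0 : 0 ≤ M := (abs_nonneg _).trans (hM 0 ha0)
  calc |h t| ≤ M / 2 * (|t| * |t - ϑ|) := hup
    _ = M / (2 * c) * (c * (|t| * |t - ϑ|)) := by field_simp
    _ ≤ M / (2 * c) * |f t| := mul_le_mul_of_nonneg_left hlow (by positivity)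

/-- **Transport along a displacement** (pure bookkeeping): if `|h| ≤ q·|f|` at a point, `|H − h| ≤ ℓ₁` and `|F − f| ≤ ℓ₀` there (`0 ≤ q`), then
`|H| ≤ q·|F| + (q·ℓ₀ + ℓ₁)` — used with `ℓᵢ = (level row)·|e|` to move the two-node control off the loop's Fermi level. -/
theorem abs_le_mul_abs_add_of_displacement {f h F H q ℓ₀ ℓ₁ : ℝ} (hq : 0 ≤ q) (hhf : |h| ≤ q * |f|) (hH : |H - h| ≤ ℓ₁) (hF : |F - f| ≤ ℓ₀) :
    |H| ≤ q * |F| + (q * ℓ₀ + ℓ₁) := by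
  have h1 : |H| ≤ |h| + ℓ₁ := by
    have := abs_sub_abs_le_abs_sub H h; linarith
  have h2 : |f| ≤ |F| + ℓ₀ := by
    have := abs_sub_abs_le_abs_sub f F; rw [abs_sub_comm] at this; linarith
  nlinarith [mul_le_mul_of_nonneg_left h2 hq]

end TwoNode

/-! ## §2 Sections of a jointly smooth function: `φ ↦ ∂ᵐ_ψ|_θ G(φ, ψ)` is smooth -/

section Sections

variable {F : Type*} [NormedAddCommGroup F] [NormedSpace ℝ F]

/-- **Iterated second-variable derivatives of a jointly `C^∞` map are sections of a jointly `C^∞` map**: for `G : ℝ × ℝ → F` smooth and every `m`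
there is a smooth `Gm` with `∂ᵐ_ψ[G(y,·)](ψ) = Gm(y, ψ)` for all `y, ψ` (induction with `iteratedDeriv_section_succ`, `contDiff_fderiv_apply_section`). -/
theorem exists_contDiff_section_iteratedDeriv (m : ℕ) :
    ∀ {G : ℝ × ℝ → F}, ContDiff ℝ ∞ G → ∃ Gm : ℝ × ℝ → F, ContDiff ℝ ∞ Gm ∧ ∀ y ψ, iteratedDeriv m (fun ψ : ℝ => G (y, ψ)) ψ = Gm (y, ψ) := by
  induction m with
  | zero => intro G hG; exact ⟨G, hG, fun y ψ => by rw [iteratedDeriv_zero]⟩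
  | succ k ih =>
    intro G hG
    obtain ⟨Gk, hGk, hGk_eq⟩ := ih (contDiff_fderiv_apply_section (V := ℝ) hG)
    refine ⟨Gk, hGk, fun y ψ => ?_⟩
    rw [iteratedDeriv_section_succ (V := ℝ) hG k y ψ, hGk_eq]

/-- Hence `φ ↦ ∂ᵐ_ψ|_θ G(φ, ψ)` (jet in the second variable at a fixed `θ`, read as a function of the first) is `C^∞`. -/
theorem contDiff_iteratedDeriv_section {G : ℝ × ℝ → F} (hG : ContDiff ℝ ∞ G) (m : ℕ) (θ : ℝ) {n : ℕ∞} :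
    ContDiff ℝ n fun φ : ℝ => iteratedDeriv m (fun ψ : ℝ => G (φ, ψ)) θ := by
  obtain ⟨Gm, hGm, h⟩ := exists_contDiff_section_iteratedDeriv m hG
  have hfun : (fun φ : ℝ => iteratedDeriv m (fun ψ : ℝ => G (φ, ψ)) θ) = fun φ => Gm (φ, θ) := funext fun φ => h φ θ
  rw [hfun]
  exact (hGm.of_le (by exact_mod_cast le_top)).comp (contDiff_id.prodMk contDiff_const)

end Sections

/-! ## §3 The pp partner band at the loop's Fermi level: θ-fixed zeros, smooth jet profiles, two-node control -/

section PartnerBand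

variable {a b : ℝ} (B : BandBounds a b) {K : TrigPolyC4v} {A : ℝ}
  (hA : ∀ p : Momentum, ∀ j ≤ 2, ‖iteratedFDeriv ℝ j (frameShift K) p‖ ≤ A) (hADt : 2 * A < B.Dtmin)
  {μ r : ℝ} (hr : 0 < r) (hlo : a < μ - r - A) (hhi : μ + r + A < b)
include B hA hADt hr hlo hhi

omit hADt in
/-- **θ-fixed zero at the loop point `k`** (`φ = 0`, loop level `0`, `ρ = 0`): the partner is `q′ = Φ(0, ϑ+ψ)`, on the Fermi curve, for EVERY base angle:
`e_K(Φ(0,ψ) + Φ(0,ϑ+ψ) − Φ(0, 0+ψ)) = 0`. -/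
theorem partnerBand_pp_level_zero_at_k (ϑ ψ : ℝ) :
    frameLevel μ K (levelPoint μ K 0 ψ + levelPoint μ K 0 (ϑ + ψ) - levelPoint μ K 0 (0 + ψ)) = 0 := by
  rw [zero_add, show levelPoint μ K 0 ψ + levelPoint μ K 0 (ϑ + ψ) - levelPoint μ K 0 ψ = levelPoint μ K 0 (ϑ + ψ) by abel]
  exact frameLevel_levelPoint_zero B hA hr hlo hhi _

omit hADt in
/-- **θ-fixed zero at the loop point `q′`** (`φ = ϑ`, loop level `0`, `ρ = 0`): the partner is `k = Φ(0,ψ)`: `e_K(Φ(0,ψ) + Φ(0,ϑ+ψ) − Φ(0, ϑ+ψ)) = 0`. -/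
theorem partnerBand_pp_level_zero_at_q (ϑ ψ : ℝ) :
    frameLevel μ K (levelPoint μ K 0 ψ + levelPoint μ K 0 (ϑ + ψ) - levelPoint μ K 0 (ϑ + ψ)) = 0 := by
  rw [show levelPoint μ K 0 ψ + levelPoint μ K 0 (ϑ + ψ) - levelPoint μ K 0 (ϑ + ψ) = levelPoint μ K 0 ψ by abel]
  exact frameLevel_levelPoint_zero B hA hr hlo hhi _

omit hADt in
/-- **Every base-angle jet vanishes at the crossing `φ = 0`** (the profile is identically zero in `ψ`). -/
theorem iteratedDeriv_partnerBand_pp_base_at_k (ϑ θ : ℝ) (m : ℕ) :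
    iteratedDeriv m (fun ψ : ℝ => frameLevel μ K (levelPoint μ K 0 ψ + levelPoint μ K 0 (ϑ + ψ) - levelPoint μ K 0 (0 + ψ))) θ = 0 := by
  have hfun : (fun ψ : ℝ => frameLevel μ K (levelPoint μ K 0 ψ + levelPoint μ K 0 (ϑ + ψ) - levelPoint μ K 0 (0 + ψ))) = fun _ => (0 : ℝ) :=
    funext fun ψ => partnerBand_pp_level_zero_at_k B hA hr hlo hhi ϑ ψ
  rw [hfun, iteratedDeriv_const]
  cases m <;> simp

omit hADt in
/-- **Every base-angle jet vanishes at the crossing `φ = ϑ`**. -/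
theorem iteratedDeriv_partnerBand_pp_base_at_q (ϑ θ : ℝ) (m : ℕ) :
    iteratedDeriv m (fun ψ : ℝ => frameLevel μ K (levelPoint μ K 0 ψ + levelPoint μ K 0 (ϑ + ψ) - levelPoint μ K 0 (ϑ + ψ))) θ = 0 := by
  have hfun : (fun ψ : ℝ => frameLevel μ K (levelPoint μ K 0 ψ + levelPoint μ K 0 (ϑ + ψ) - levelPoint μ K 0 (ϑ + ψ))) = fun _ => (0 : ℝ) :=
    funext fun ψ => partnerBand_pp_level_zero_at_q B hA hr hlo hhi ϑ ψ
  rw [hfun, iteratedDeriv_const]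
  cases m <;> simp

/-- **Joint smoothness** of `(φ, ψ) ↦ e_K(Φ(0,ψ) + Φ(ρ,ϑ+ψ) − Φ(e,φ+ψ))` on the tube (`|ρ|, |e| < r`). -/
theorem contDiff_partnerBand_pp_uncurry {ρ e : ℝ} (hρ : |ρ| < r) (he : |e| < r) (ϑ : ℝ) :
    ContDiff ℝ ∞ fun x : ℝ × ℝ => frameLevel μ K (levelPoint μ K 0 x.2 + levelPoint μ K ρ (ϑ + x.2) - levelPoint μ K e (x.1 + x.2)) := by
  have h0 : |(0 : ℝ)| < r := by rw [abs_zero]; exact hr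
  have hl : ∀ {x : ℝ}, |x| < r → ContDiff ℝ ∞ (levelPoint μ K x) := fun hx => contDiff_levelPoint_angle B hA hADt hlo hhi hx
  refine (EngineV8.contDiff_frameLevel μ K).comp ?_
  exact (((hl h0).comp contDiff_snd).add ((hl hρ).comp (contDiff_const.add contDiff_snd))).sub
    ((hl he).comp (contDiff_fst.add contDiff_snd))

/-- **The jet profiles are smooth in the loop angle**: `φ ↦ ∂ᵐ_ψ|_θ e_K(Φ(0,ψ) + Φ(ρ,ϑ+ψ) − Φ(e,φ+ψ))` is `C^n` for every `n`. -/
theorem contDiff_partnerBand_pp_jet_profile {ρ e : ℝ} (hρ : |ρ| < r) (he : |e| < r) (ϑ θ : ℝ) (m : ℕ) {n : ℕ∞} :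
    ContDiff ℝ n fun φ : ℝ =>
      iteratedDeriv m (fun ψ : ℝ => frameLevel μ K (levelPoint μ K 0 ψ + levelPoint μ K ρ (ϑ + ψ) - levelPoint μ K e (φ + ψ))) θ :=
  contDiff_iteratedDeriv_section (contDiff_partnerBand_pp_uncurry B hA hADt hr hlo hhi hρ he ϑ) m θ

/-- **TWO-NODE CONTROL OF THE CO-MOVING JETS OF THE pp PARTNER BAND AT THE LOOP'S FERMI LEVEL** (`ρ = 0`, `e = 0`, `ϑ ≠ 0`).  On a loop-angle window
`[a′, b′] ∋ 0, ϑ` on which the level-`0` profile `φ ↦ ē(0,φ) = e_K(Φ(0,θ) + Φ(0,ϑ+θ) − Φ(0,φ+θ))` has the curvature floor `2c ≤ ∂²_φ ē(0,·)` (`0 < c`) and the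
`m`-th base-angle jet profile `φ ↦ ∂ᵐ_ψ|_θ ē` has `|∂²_φ(∂ᵐ_ψ|_θ ē)| ≤ M`:
`|∂ᵐ_ψ|_θ e_K(Φ(0,ψ) + Φ(0,ϑ+ψ) − Φ(0,φ+ψ))| ≤ (M/(2c))·|e_K(Φ(0,θ) + Φ(0,ϑ+θ) − Φ(0,φ+θ))|` for every `φ ∈ [a′,b′]` —
the anisotropy defect of every order is bounded by the PARTNER'S BAND DISTANCE, uniformly in the crossing separation `|ϑ|`. -/
theorem abs_iteratedDeriv_partnerBand_pp_base_le_mul_abs {ϑ : ℝ} (hϑ : ϑ ≠ 0) (θ : ℝ) (m : ℕ) {a' b' : ℝ} (hab : a' < b')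
    (ha0 : (0 : ℝ) ∈ Icc a' b') (hϑab : ϑ ∈ Icc a' b') {c M : ℝ} (hc0 : 0 < c)
    (hc : ∀ x ∈ Icc a' b', 2 * c ≤ iteratedDeriv 2
      (fun φ : ℝ => frameLevel μ K (levelPoint μ K 0 θ + levelPoint μ K 0 (ϑ + θ) - levelPoint μ K 0 (φ + θ))) x)
    (hM : ∀ x ∈ Icc a' b', |iteratedDeriv 2 (fun φ : ℝ =>
      iteratedDeriv m (fun ψ : ℝ => frameLevel μ K (levelPoint μ K 0 ψ + levelPoint μ K 0 (ϑ + ψ) - levelPoint μ K 0 (φ + ψ))) θ) x| ≤ M)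
    {φ : ℝ} (hφ : φ ∈ Icc a' b') :
    |iteratedDeriv m (fun ψ : ℝ => frameLevel μ K (levelPoint μ K 0 ψ + levelPoint μ K 0 (ϑ + ψ) - levelPoint μ K 0 (φ + ψ))) θ| ≤
      M / (2 * c) * |frameLevel μ K (levelPoint μ K 0 θ + levelPoint μ K 0 (ϑ + θ) - levelPoint μ K 0 (φ + θ))| := by
  have h0 : |(0 : ℝ)| < r := by rw [abs_zero]; exact hr
  -- the two profiles: `f` = the level-0 partner band in the loop angle, `h` = its `m`-th base-angle jet profile
  have hfC : ContDiff ℝ 2 (fun φ : ℝ => frameLevel μ K (levelPoint μ K 0 θ + levelPoint μ K 0 (ϑ + θ) - levelPoint μ K 0 (φ + θ))) :=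
    (EngineV8.contDiff_frameLevel μ K).comp
      (contDiff_const.sub ((contDiff_levelPoint_angle B hA hADt hlo hhi h0).comp (contDiff_id.add contDiff_const)))
  have hhC : ContDiff ℝ 2 (fun φ : ℝ =>
      iteratedDeriv m (fun ψ : ℝ => frameLevel μ K (levelPoint μ K 0 ψ + levelPoint μ K 0 (ϑ + ψ) - levelPoint μ K 0 (φ + ψ))) θ) :=
    contDiff_partnerBand_pp_jet_profile B hA hADt hr hlo hhi h0 h0 ϑ θ m
  exact abs_le_mul_abs_of_two_zeros hfC hhC hϑ (partnerBand_pp_level_zero_at_k B hA hr hlo hhi ϑ θ)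
    (partnerBand_pp_level_zero_at_q B hA hr hlo hhi ϑ θ) (iteratedDeriv_partnerBand_pp_base_at_k B hA hr hlo hhi ϑ θ m)
    (iteratedDeriv_partnerBand_pp_base_at_q B hA hr hlo hhi ϑ θ m) hab ha0 hϑab hc0 hc hM hφ

/-- **… transported off the loop's Fermi level** (`e ≠ 0`) by the level rows: if in addition `|∂ᵐ_ψ|_θ ē(e,φ) − ∂ᵐ_ψ|_θ ē(0,φ)| ≤ ℓ_m·|e|` and
`|ē(e,φ) − ē(0,φ)| ≤ ℓ₀·|e|` (the shape of `…TangencyDefectSharp.abs_iteratedDeriv_partnerBand_pp_sub_level_le_sharp`, via `iteratedDeriv_partnerBand_pp_base_eq`),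
then `|∂ᵐ_ψ|_θ ē(e,φ)| ≤ (M/(2c))·|ē(e,φ)| + ((M/(2c))·ℓ₀ + ℓ_m)·|e|` — BAND-DISTANCE CONTROL `≲ |ē| + |e|` of the co-moving jets on the direct sheet. -/
theorem abs_iteratedDeriv_partnerBand_pp_base_le_mul_abs_add_level {ϑ : ℝ} (hϑ : ϑ ≠ 0) (θ : ℝ) (m : ℕ) {a' b' : ℝ} (hab : a' < b')
    (ha0 : (0 : ℝ) ∈ Icc a' b') (hϑab : ϑ ∈ Icc a' b') {c M : ℝ} (hc0 : 0 < c)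
    (hc : ∀ x ∈ Icc a' b', 2 * c ≤ iteratedDeriv 2
      (fun φ : ℝ => frameLevel μ K (levelPoint μ K 0 θ + levelPoint μ K 0 (ϑ + θ) - levelPoint μ K 0 (φ + θ))) x)
    (hM : ∀ x ∈ Icc a' b', |iteratedDeriv 2 (fun φ : ℝ =>
      iteratedDeriv m (fun ψ : ℝ => frameLevel μ K (levelPoint μ K 0 ψ + levelPoint μ K 0 (ϑ + ψ) - levelPoint μ K 0 (φ + ψ))) θ) x| ≤ M)
    {e : ℝ} {ℓ₀ ℓm : ℝ} {φ : ℝ} (hφ : φ ∈ Icc a' b')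
    (hℓ₀ : |frameLevel μ K (levelPoint μ K 0 θ + levelPoint μ K 0 (ϑ + θ) - levelPoint μ K e (φ + θ)) -
        frameLevel μ K (levelPoint μ K 0 θ + levelPoint μ K 0 (ϑ + θ) - levelPoint μ K 0 (φ + θ))| ≤ ℓ₀ * |e|)
    (hℓm : |iteratedDeriv m (fun ψ : ℝ => frameLevel μ K (levelPoint μ K 0 ψ + levelPoint μ K 0 (ϑ + ψ) - levelPoint μ K e (φ + ψ))) θ -
        iteratedDeriv m (fun ψ : ℝ => frameLevel μ K (levelPoint μ K 0 ψ + levelPoint μ K 0 (ϑ + ψ) - levelPoint μ K 0 (φ + ψ))) θ| ≤ ℓm * |e|) :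
    |iteratedDeriv m (fun ψ : ℝ => frameLevel μ K (levelPoint μ K 0 ψ + levelPoint μ K 0 (ϑ + ψ) - levelPoint μ K e (φ + ψ))) θ| ≤
      M / (2 * c) * |frameLevel μ K (levelPoint μ K 0 θ + levelPoint μ K 0 (ϑ + θ) - levelPoint μ K e (φ + θ))| +
        (M / (2 * c) * ℓ₀ + ℓm) * |e| := by
  have hbase := abs_iteratedDeriv_partnerBand_pp_base_le_mul_abs B hA hADt hr hlo hhi hϑ θ m hab ha0 hϑab hc0 hc hM hφ
  have hM0 : 0 ≤ M := (abs_nonneg _).trans (hM 0 ha0)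
  have hq : 0 ≤ M / (2 * c) := by positivity
  have h := abs_le_mul_abs_add_of_displacement hq hbase hℓm hℓ₀
  calc _ ≤ M / (2 * c) * |frameLevel μ K (levelPoint μ K 0 θ + levelPoint μ K 0 (ϑ + θ) - levelPoint μ K e (φ + θ))| +
        (M / (2 * c) * (ℓ₀ * |e|) + ℓm * |e|) := h
    _ = _ := by ring

end PartnerBand

end Summit.HubbardSuperconductivity.HubbardSuperconductivity.Theorems.C4a

end
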